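import Summits.Ventures.LatticeQCDFlow.Scoring.SU2TorusPlaquettePairSeries
import Summits.Ventures.LatticeQCDFlow.Scoring.SU2TorusPlaquettePairEstimate
import HarnessLib

/-!
# SU(2) on the 2-torus: THE EXACT PAIR CORRELATION `⟨½ tr U_p · ½ tr U_q⟩` AND `|Cov(½ tr U_p, ½ tr U_q)| ≤ (I₂/I₁)^{L²−2}·(15/16 + (101/16) Σ_n I_{n+2}/I₁)` — DISTINCT PLAQUETTES ARE UNCORRELATED UP TO `r^{L²−2}`

HONEST FRAMING: exact (Metropolis-corrected) sampling algorithms for lattice gauge theory;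
figures of merit are autocorrelation/cost numbers at stated couplings and volumes; no
continuum-physics claim.

Venture `LatticeQCDFlow` (cell pub-lqcd), sub-topic `Scoring`; FANOUT row 5 (`s0-sun-a`), GEN-12.
NEW WORK of the cell (placement rule).  With `c_n(β) = e^{−2β}(I_n(2β) − I_{n+2}(2β))`, `λ_n = c_n/(n+1) =
e^{−2β} I_{n+1}(2β)/β`, `r = λ_1/λ_0 = I₂(2β)/I₁(2β)`:

* **`wilson_mean_su2a0_pair_plaquette_two`** — THE EXACT PAIR CORRELATION: for every `L ≥ 1`, `β ≥ 0` and
  two DISTINCT plaquettes `x₀ ≠ y₀` of `(ℤ/L)²`, under theory-2's Wilson measure: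
  `⟨½ tr U_{x₀} · ½ tr U_{y₀}⟩ = ¼ Σ_n [c_n² c_{n+1}^{L²−2}/(n+2)^{L²} + 2 c_n c_{n+2} c_{n+1}^{L²−2}/(n+2)^{L²}
  + c_{n+1}² c_n^{L²−2}/(n+1)^{L²}] / Σ_n (c_n/(n+1))^{L²}` — THE SAME FOR EVERY PAIR OF DISTINCT PLAQUETTES, adjacent
  or not (two-dimensional Yang–Mills is invariant under area-preserving rearrangements);
* **`abs_wilson_mean_su2a0_pair_plaquette_two_sub_le`** — for `β > 0`, `x₀ ≠ y₀`:
  `|⟨½ tr U_{x₀} · ½ tr U_{y₀}⟩_{(ℤ/L)²,β} − (I₂(2β)/I₁(2β))²| ≤ (I₂(2β)/I₁(2β))^{L²−2}·(7/16 + (21/16) Σ_n I_{n+2}(2β)/I₁(2β))`;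
* **`abs_covariance_su2a0_plaquette_two_le`** — THE PLAQUETTES OF THE 2-TORUS ARE PAIRWISE UNCORRELATED UP TO
  AN EXPONENTIALLY SMALL AMOUNT: for `β > 0` and ANY two distinct plaquettes `x₀ ≠ y₀`,
  `|⟨a₀(U_{x₀}) a₀(U_{y₀})⟩ − ⟨a₀(U_{x₀})⟩⟨a₀(U_{y₀})⟩| ≤ (I₂(2β)/I₁(2β))^{L²−2}·(15/16 + (101/16) Σ_n I_{n+2}(2β)/I₁(2β))`
  (`a₀ = ½ tr`; at the cell's `16²`, `b = 2.2` point the right side is below `10⁻⁸³`): in two dimensions the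
  plaquette variables are independent in infinite volume (a gauge-fixing fact); on the finite torus the ONLY
  correlation between any two of them is the global constraint, of relative size `r^{L²−2}`.

With `SU2TorusPlaquetteSquareFiniteVolume` (the single-plaquette variance `v(β) + O(r^{L²−1})`) this gives the
error-bar oracle `Var(P̄) = v(β)/L² + O(r^{L²−2})` for the volume-averaged plaquette (`SU2TorusPlaquetteAverageVariance`).
Nothing is cited; no `def`.
-/

noncomputable section

open Real MeasureTheory Set Function Finset Filter Topology Polynomial.Chebyshev
open Literature.MathematicalPhysics.QuantumFieldTheory Literature.MathematicalPhysics.QuantumLattice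
open Literature.Analysis.FunctionSpaces
open Summit.Ventures.LatticeQCDFlow.Exactness
open Summit.Ventures.LatticeQCDFlow.Theory2.Lattice

namespace Summit.Ventures.LatticeQCDFlow.Scoring

/-! ## §1. The exact pair correlation -/

/-- **`∫ a₀(U_{x₀}) a₀(U_{y₀}) e^{−βS} dHaar^{⊗E}`** as the series (`β ≥ 0`, `x₀ ≠ y₀`). -/
theorem integral_su2a0_pair_mul_exp_neg_wilsonAction_two {L : ℕ} [NeZero L] {β : ℝ} (hβ : 0 ≤ β)
    {x₀ y₀ : Site 2 L}
    (hxy : x₀ ≠ y₀) :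
    ∫ V, su2a0 (plaquetteHolonomy V x₀ 0 1) * su2a0 (plaquetteHolonomy V y₀ 0 1) *
          Real.exp (-β * wilsonAction (fundamentalRep (Fin 2)) V)
        ∂(Measure.pi fun _ : Edge 2 L => haarProbability (Matrix.specialUnitaryGroup (Fin 2) ℂ)) =
      ∑' n : ℕ, (1 / 4) *
        ((Real.exp (-(2 * β)) * (besselI n (2 * β) - besselI (n + 2) (2 * β))) ^ 2 *
            (Real.exp (-(2 * β)) * (besselI (n + 1) (2 * β) - besselI (n + 1 + 2) (2 * β))) ^ (L ^ 2 - 2) *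
            ((((n : ℝ) + 1 + 1) ^ (L ^ 2)))⁻¹ +
          2 * ((Real.exp (-(2 * β)) * (besselI n (2 * β) - besselI (n + 2) (2 * β))) *
            (Real.exp (-(2 * β)) * (besselI (n + 2) (2 * β) - besselI (n + 2 + 2) (2 * β))) *
            (Real.exp (-(2 * β)) * (besselI (n + 1) (2 * β) - besselI (n + 1 + 2) (2 * β))) ^ (L ^ 2 - 2) *
            ((((n : ℝ) + 1 + 1) ^ (L ^ 2)))⁻¹) +
          (Real.exp (-(2 * β)) * (besselI (n + 1) (2 * β) - besselI (n + 1 + 2) (2 * β))) ^ 2 *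
            (Real.exp (-(2 * β)) * (besselI n (2 * β) - besselI (n + 2) (2 * β))) ^ (L ^ 2 - 2) *
            ((((n : ℝ) + 1) ^ (L ^ 2)))⁻¹) :=
  (hasSum_integral_su2a0_pair_mul_exp_neg_wilsonAction_two hβ hxy).tsum_eq.symm

/-! ## §3. The exact pair correlation -/

/-- **THE EXACT PAIR CORRELATION OF TWO DISTINCT PLAQUETTES ON THE 2-TORUS.**  For every `L ≥ 1`, `β ≥ 0` and
`x₀ ≠ y₀` in `(ℤ/L)²`, under theory-2's Wilson measure `wilsonMeasure (fundamentalRep (Fin 2)) β`: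
`⟨½ tr U_{x₀} · ½ tr U_{y₀}⟩ = ¼ Σ_n [c_n² c_{n+1}^{L²−2}/(n+2)^{L²} + 2 c_n c_{n+2} c_{n+1}^{L²−2}/(n+2)^{L²}
+ c_{n+1}² c_n^{L²−2}/(n+1)^{L²}] / Σ_n (c_n/(n+1))^{L²}`, `c_n = e^{−2β}(I_n(2β) − I_{n+2}(2β))` — independent of
WHICH two distinct plaquettes. -/
theorem wilson_mean_su2a0_pair_plaquette_two {L : ℕ} [NeZero L] {β : ℝ} (hβ : 0 ≤ β) {x₀ y₀ : Site 2 L}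
    (hxy : x₀ ≠ y₀) :
    ∫ V, su2a0 (plaquetteHolonomy V x₀ 0 1) * su2a0 (plaquetteHolonomy V y₀ 0 1)
        ∂(wilsonMeasure (d := 2) (L := L) (fundamentalRep (Fin 2)) β) =
      (∑' n : ℕ, (1 / 4) *
        ((Real.exp (-(2 * β)) * (besselI n (2 * β) - besselI (n + 2) (2 * β))) ^ 2 *
            (Real.exp (-(2 * β)) * (besselI (n + 1) (2 * β) - besselI (n + 1 + 2) (2 * β))) ^ (L ^ 2 - 2) *
            ((((n : ℝ) + 1 + 1) ^ (L ^ 2)))⁻¹ +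
          2 * ((Real.exp (-(2 * β)) * (besselI n (2 * β) - besselI (n + 2) (2 * β))) *
            (Real.exp (-(2 * β)) * (besselI (n + 2) (2 * β) - besselI (n + 2 + 2) (2 * β))) *
            (Real.exp (-(2 * β)) * (besselI (n + 1) (2 * β) - besselI (n + 1 + 2) (2 * β))) ^ (L ^ 2 - 2) *
            ((((n : ℝ) + 1 + 1) ^ (L ^ 2)))⁻¹) +
          (Real.exp (-(2 * β)) * (besselI (n + 1) (2 * β) - besselI (n + 1 + 2) (2 * β))) ^ 2 *
            (Real.exp (-(2 * β)) * (besselI n (2 * β) - besselI (n + 2) (2 * β))) ^ (L ^ 2 - 2) *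
            ((((n : ℝ) + 1) ^ (L ^ 2)))⁻¹)) /
      ∑' n : ℕ, (Real.exp (-(2 * β)) * (besselI n (2 * β) - besselI (n + 2) (2 * β)) /
        ((n : ℝ) + 1)) ^ (L ^ 2) := by
  rw [integral_wilsonMeasure_su2_eq_div, integral_su2a0_pair_mul_exp_neg_wilsonAction_two hβ hxy,
    partitionFunction_su2_two_toReal_eq_tsum hβ]


/-! ## §2. The SU(2) torus: the pair correlation up to an exponentially small remainder -/

/-- Two distinct sites force `L² ≥ 2` (indeed `L ≥ 2`). -/
theorem two_le_sq_of_ne {L : ℕ} [NeZero L] {x₀ y₀ : Site 2 L} (hxy : x₀ ≠ y₀) : 3 ≤ L ^ 2 := by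
  have h1 : 1 < Fintype.card (Site 2 L) := Fintype.one_lt_card_iff_nontrivial.mpr ⟨⟨x₀, y₀, hxy⟩⟩
  rw [Flux.card_site_two] at h1
  have hL : 2 ≤ L := by
    by_contra h
    have : L = 1 := by have := NeZero.ne L; omega
    subst this
    simp at h1
  nlinarith

/-- **`|⟨½ tr U_{x₀} · ½ tr U_{y₀}⟩_{(ℤ/L)²,β} − (I₂(2β)/I₁(2β))²| ≤ (I₂(2β)/I₁(2β))^{L²−2}·(7/16 + (21/16) Σ_n I_{n+2}(2β)/I₁(2β))`**
for `β > 0` and two distinct plaquettes `x₀ ≠ y₀` of `(ℤ/L)²`. -/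
theorem abs_wilson_mean_su2a0_pair_plaquette_two_sub_le {L : ℕ} [NeZero L] {β : ℝ} (hβ : 0 < β)
    {x₀ y₀ : Site 2 L} (hxy : x₀ ≠ y₀) :
    |∫ V, su2a0 (plaquetteHolonomy V x₀ 0 1) * su2a0 (plaquetteHolonomy V y₀ 0 1)
        ∂(wilsonMeasure (d := 2) (L := L) (fundamentalRep (Fin 2)) β) -
        (besselI 2 (2 * β) / besselI 1 (2 * β)) ^ 2| ≤
      (besselI 2 (2 * β) / besselI 1 (2 * β)) ^ (L ^ 2 - 2) *
        (7 / 16 + 21 / 16 * (∑' n : ℕ, besselI (n + 2) (2 * β)) / besselI 1 (2 * β)) := by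
  set w : ℕ → ℝ := fun n => Real.exp (-(2 * β)) * (besselI n (2 * β) - besselI (n + 2) (2 * β)) /
    ((n : ℝ) + 1) with hw
  have hanti : Antitone w := charCoeff_div_succ_antitone hβ
  have hpos : ∀ n, 0 < w n := charCoeff_div_succ_pos hβ
  have hsum : Summable w := summable_charCoeff_div_succ hβ.le
  have hV := two_le_sq_of_ne hxy
  obtain ⟨v, hv⟩ : ∃ v, L ^ 2 = v + 3 := ⟨L ^ 2 - 3, by omega⟩
  have hv2 : L ^ 2 - 2 = v + 1 := by omega
  have habs := abs_div_tsum_pair_sub_le hanti hpos hsum v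
  -- identify the series
  have hw' : ∀ n, w n = Real.exp (-(2 * β)) * besselI (n + 1) (2 * β) / β := fun n =>
    charCoeff_div_succ_eq_besselI n hβ.ne'
  have hI1 : 0 < besselI 1 (2 * β) := besselI_pos 1 (by linarith)
  have he : 0 < Real.exp (-(2 * β)) := Real.exp_pos _
  have hratio : w 1 / w 0 = besselI 2 (2 * β) / besselI 1 (2 * β) := by
    rw [hw' 1, hw' 0]
    field_simp
  have hS : 21 / 16 * (∑' n : ℕ, w (n + 1)) / w 0 =
      21 / 16 * (∑' n : ℕ, besselI (n + 2) (2 * β)) / besselI 1 (2 * β) := by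
    have h1 : (fun n : ℕ => w (n + 1)) = fun n => (Real.exp (-(2 * β)) / β) * besselI (n + 2) (2 * β) := by
      funext n; rw [hw' (n + 1)]; ring
    rw [h1, tsum_mul_left, hw' 0]
    field_simp
  have hcw : ∀ n : ℕ, Real.exp (-(2 * β)) * (besselI n (2 * β) - besselI (n + 2) (2 * β)) =
      ((n : ℝ) + 1) * w n := by
    intro n
    rw [hw]
    field_simp
  have hnum : ∀ n : ℕ, (1 / 4 : ℝ) *
      ((Real.exp (-(2 * β)) * (besselI n (2 * β) - besselI (n + 2) (2 * β))) ^ 2 *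
          (Real.exp (-(2 * β)) * (besselI (n + 1) (2 * β) - besselI (n + 1 + 2) (2 * β))) ^ (L ^ 2 - 2) *
          ((((n : ℝ) + 1 + 1) ^ (L ^ 2)))⁻¹ +
        2 * ((Real.exp (-(2 * β)) * (besselI n (2 * β) - besselI (n + 2) (2 * β))) *
          (Real.exp (-(2 * β)) * (besselI (n + 2) (2 * β) - besselI (n + 2 + 2) (2 * β))) *
          (Real.exp (-(2 * β)) * (besselI (n + 1) (2 * β) - besselI (n + 1 + 2) (2 * β))) ^ (L ^ 2 - 2) *
          ((((n : ℝ) + 1 + 1) ^ (L ^ 2)))⁻¹) +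
        (Real.exp (-(2 * β)) * (besselI (n + 1) (2 * β) - besselI (n + 1 + 2) (2 * β))) ^ 2 *
          (Real.exp (-(2 * β)) * (besselI n (2 * β) - besselI (n + 2) (2 * β))) ^ (L ^ 2 - 2) *
          ((((n : ℝ) + 1) ^ (L ^ 2)))⁻¹) =
      (1 / 4 : ℝ) * (w n ^ 2 * w (n + 1) ^ (v + 1) * (((n : ℝ) + 1) ^ 2 / ((n : ℝ) + 2) ^ 2) +
        2 * (w n * w (n + 2) * w (n + 1) ^ (v + 1)) * (((n : ℝ) + 1) * ((n : ℝ) + 3) / ((n : ℝ) + 2) ^ 2) +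
        w (n + 1) ^ 2 * w n ^ (v + 1) * (((n : ℝ) + 2) ^ 2 / ((n : ℝ) + 1) ^ 2)) := by
    intro n
    rw [hcw n, hcw (n + 1), hcw (n + 2), hv2, hv]
    have hn1 : ((n : ℝ) + 1) ≠ 0 := by positivity
    have hn2 : ((n : ℝ) + 2) ≠ 0 := by positivity
    have hc1 : (((n + 1 : ℕ) : ℝ) + 1) = (n : ℝ) + 2 := by push_cast; ring
    have hc2 : (((n + 2 : ℕ) : ℝ) + 1) = (n : ℝ) + 3 := by push_cast; ring
    have hc3 : ((n : ℝ) + 1 + 1) = (n : ℝ) + 2 := by ring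
    rw [hc1, hc2, hc3, mul_pow, mul_pow, mul_pow, mul_pow]
    field_simp
    ring
  have hden : ∀ n : ℕ, (Real.exp (-(2 * β)) * (besselI n (2 * β) - besselI (n + 2) (2 * β)) /
      ((n : ℝ) + 1)) ^ (L ^ 2) = w n ^ (v + 3) := fun n => by rw [hv]
  rw [wilson_mean_su2a0_pair_plaquette_two hβ.le hxy, tsum_congr hnum, tsum_congr hden, ← hratio, ← hS, hv2]
  exact habs

/-- **THE PLAQUETTES OF THE 2-TORUS ARE PAIRWISE UNCORRELATED UP TO `r^{L²−2}`.**  For `β > 0` and ANY two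
distinct plaquettes `x₀ ≠ y₀` of `(ℤ/L)²`, under theory-2's Wilson measure:
`|⟨a₀(U_{x₀}) a₀(U_{y₀})⟩ − ⟨a₀(U_{x₀})⟩⟨a₀(U_{y₀})⟩| ≤ (I₂(2β)/I₁(2β))^{L²−2}·(15/16 + (101/16) Σ_n I_{n+2}(2β)/I₁(2β))`
(`a₀ = ½ tr`).  At the cell's `16²`, `b = 2.2` point the right side is below `10⁻⁸³`. -/
theorem abs_covariance_su2a0_plaquette_two_le {L : ℕ} [NeZero L] {β : ℝ} (hβ : 0 < β)
    {x₀ y₀ : Site 2 L} (hxy : x₀ ≠ y₀) :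
    |∫ V, su2a0 (plaquetteHolonomy V x₀ 0 1) * su2a0 (plaquetteHolonomy V y₀ 0 1)
        ∂(wilsonMeasure (d := 2) (L := L) (fundamentalRep (Fin 2)) β) -
        (∫ V, su2a0 (plaquetteHolonomy V x₀ 0 1) ∂(wilsonMeasure (d := 2) (L := L) (fundamentalRep (Fin 2)) β)) *
        (∫ V, su2a0 (plaquetteHolonomy V y₀ 0 1) ∂(wilsonMeasure (d := 2) (L := L) (fundamentalRep (Fin 2)) β))| ≤
      (besselI 2 (2 * β) / besselI 1 (2 * β)) ^ (L ^ 2 - 2) *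
        (15 / 16 + 101 / 16 * (∑' n : ℕ, besselI (n + 2) (2 * β)) / besselI 1 (2 * β)) := by
  haveI := secondCountableTopology_su2
  have h2 := abs_wilson_mean_su2a0_pair_plaquette_two_sub_le hβ hxy
  have hx := abs_wilson_mean_su2a0_plaquette_two_sub_le hβ x₀
  have hy := abs_wilson_mean_su2a0_plaquette_two_sub_le hβ y₀
  obtain ⟨hr0, hr1⟩ := besselI_two_div_one_lt_one hβ
  have hV := two_le_sq_of_ne hxy
  set r : ℝ := besselI 2 (2 * β) / besselI 1 (2 * β) with hr
  set S : ℝ := (∑' n : ℕ, besselI (n + 2) (2 * β)) / besselI 1 (2 * β) with hS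
  set P : ℝ := ∫ V, su2a0 (plaquetteHolonomy V x₀ 0 1)
    ∂(wilsonMeasure (d := 2) (L := L) (fundamentalRep (Fin 2)) β) with hP
  set P' : ℝ := ∫ V, su2a0 (plaquetteHolonomy V y₀ 0 1)
    ∂(wilsonMeasure (d := 2) (L := L) (fundamentalRep (Fin 2)) β) with hP'
  set Q : ℝ := ∫ V, su2a0 (plaquetteHolonomy V x₀ 0 1) * su2a0 (plaquetteHolonomy V y₀ 0 1)
    ∂(wilsonMeasure (d := 2) (L := L) (fundamentalRep (Fin 2)) β) with hQ
  have hS0 : 0 ≤ S := div_nonneg (tsum_nonneg fun n => besselI_nonneg _ (by linarith))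
    (besselI_pos 1 (by linarith)).le
  -- `|P| ≤ 1`
  have hbound : ∀ z : Site 2 L, |∫ V, su2a0 (plaquetteHolonomy V z 0 1)
      ∂(wilsonMeasure (d := 2) (L := L) (fundamentalRep (Fin 2)) β)| ≤ 1 := by
    intro z
    haveI : IsProbabilityMeasure (wilsonMeasure (d := 2) (L := L) (fundamentalRep (Fin 2)) β) :=
      isProbabilityMeasure_wilsonMeasure (d := 2) (L := L) (fundamentalRep (Fin 2))
        (continuous_fundamentalRep _) β
    refine (abs_integral_le_integral_abs).trans ?_
    have h : ∫ V, |su2a0 (plaquetteHolonomy V z 0 1)|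
        ∂(wilsonMeasure (d := 2) (L := L) (fundamentalRep (Fin 2)) β) ≤ ∫ V, (1 : ℝ)
        ∂(wilsonMeasure (d := 2) (L := L) (fundamentalRep (Fin 2)) β) := by
      refine integral_mono_of_nonneg (ae_of_all _ fun V => abs_nonneg _) (integrable_const _)
        (ae_of_all _ fun V => abs_su2a0_le_one _)
    simpa using h
  have hPle : |P| ≤ 1 := hbound x₀
  have h1' : 21 / 16 * (∑' n : ℕ, besselI (n + 2) (2 * β)) / besselI 1 (2 * β) = 21 / 16 * S := by
    rw [hS, mul_div_assoc]
  have h2' : 5 / 2 * (∑' n : ℕ, besselI (n + 2) (2 * β)) / besselI 1 (2 * β) = 5 / 2 * S := by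
    rw [hS, mul_div_assoc]
  have h3' : 101 / 16 * (∑' n : ℕ, besselI (n + 2) (2 * β)) / besselI 1 (2 * β) = 101 / 16 * S := by
    rw [hS, mul_div_assoc]
  rw [h1'] at h2
  rw [h2'] at hx hy
  rw [h3']
  -- `|P P' − r²| ≤ |P − r|·|P'| + r·|P' − r| ≤ 2 r^{L²−1}(¼ + (5/2) S)`
  have hprod : |P * P' - r ^ 2| ≤ 2 * (r ^ (L ^ 2 - 1) * (1 / 4 + 5 / 2 * S)) := by
    have : P * P' - r ^ 2 = (P - r) * P' + r * (P' - r) := by ring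
    rw [this]
    calc |(P - r) * P' + r * (P' - r)| ≤ |(P - r) * P'| + |r * (P' - r)| := abs_add_le _ _
      _ = |P - r| * |P'| + r * |P' - r| := by rw [abs_mul, abs_mul, abs_of_nonneg hr0]
      _ ≤ r ^ (L ^ 2 - 1) * (1 / 4 + 5 / 2 * S) * 1 + 1 * (r ^ (L ^ 2 - 1) * (1 / 4 + 5 / 2 * S)) :=
          add_le_add (mul_le_mul hx (hbound y₀) (abs_nonneg _) (by positivity))
            (mul_le_mul hr1.le hy (abs_nonneg _) (by norm_num))
      _ = 2 * (r ^ (L ^ 2 - 1) * (1 / 4 + 5 / 2 * S)) := by ring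
  -- `r^{L²−1} ≤ r^{L²−2}`
  have hrr : r ^ (L ^ 2 - 1) ≤ r ^ (L ^ 2 - 2) := pow_le_pow_of_le_one hr0 hr1.le (by omega)
  have hK0 : 0 ≤ 1 / 4 + 5 / 2 * S := by positivity
  calc |Q - P * P'| = |(Q - r ^ 2) - (P * P' - r ^ 2)| := by ring_nf
    _ ≤ |Q - r ^ 2| + |P * P' - r ^ 2| := abs_sub _ _
    _ ≤ r ^ (L ^ 2 - 2) * (7 / 16 + 21 / 16 * S) + 2 * (r ^ (L ^ 2 - 1) * (1 / 4 + 5 / 2 * S)) :=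
        add_le_add h2 hprod
    _ ≤ r ^ (L ^ 2 - 2) * (7 / 16 + 21 / 16 * S) + 2 * (r ^ (L ^ 2 - 2) * (1 / 4 + 5 / 2 * S)) := by
        have := mul_le_mul_of_nonneg_right hrr hK0
        linarith
    _ = r ^ (L ^ 2 - 2) * (15 / 16 + 101 / 16 * S) := by ring

end Summit.Ventures.LatticeQCDFlow.Scoring
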